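import Summits.QuantumFields.BalabanUV.Beta.GradientMemberBox
import Summits.QuantumFields.BalabanUV.Beta.HarmonicMeasureBoundD4

/-!
# Beta / GradientMemberBoxD4 — THE GRADIENT MEMBER (3.42)₂'s SHAPE ON A TORUS BOX, d = 4, HYPOTHESIS-FREE:
# the pointwise Green bound of `GradientMemberBox.fdiff_le_box` DISCHARGED in Bałaban's dimension by road P3's lattice Newton potential
# (`HarmonicMeasureBoundD4.green_ball_le`: `green ≤ (3/2)·(|x − y|² + 3)⁻¹` for the unit weight), weight scaling and domain monotonicity
# (fourth module of the chain «LATTICE-GRADIENT-MEMBER»: O.2 item (i), the gradient member, at MODEL level — END for d = 4)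

WHAT IS CERTIFIED (kernel, 0 sorry).
* §1 (generic bond structure): **`green_mono_set`** — `B ⊆ B′` (both carrying unit supersolutions) ⟹ `green B x z ≤ green B′ x z`
  (comparison `green_le_of_supersolution` with the supersolution `green B′ (·) z`).
* §2 (unit torus, any `d`): **`green_const_weight`** — for the constant weight `c ≡ c₀ ≠ 0`, `green_c B x z = green_1 B x z ∕ c₀²` (uniqueness of
  the Dirichlet solution); `dist_eq_natSup`, `sup_sq_le_sqRad` (`dist(x,x₀)² ≤ sqRad x₀ x`), `sqRad_le_card_mul` (`sqRad ≤ d·dist²`).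
* §3 (`d = 4`): `erad_le_two_mul` (`⌊|x − x₀|⌋ ≤ 2·dist(x,x₀)`); **`green_box_le_d4`** — for the sup-ball `B = {dist(·,x₀) ≤ r}` with
  `16r + 4 ≤ N_μ`: `green_c B x′ y ≤ (3∕c₀²)·((dist x′ y + 1)²)⁻¹` for ALL `x′, y` (pole `y ∈ B`: `B ⊆ {⌊|· − y|⌋ < 4r+1}`, road P3's bound at
  the centre `y`, `(D+1)² ≤ 2(D² + 3)`; pole off `B`: `green = 0`);
* §4 **`fdiff_le_box_d4`** — `c ≡ c₀ ≠ 0`, `R ≥ 1`, `32R + 36 ≤ N_μ`, `B = {dist(·,x₀) ≤ 2R+2}`, `|f| ≤ M` and `|W·f − Nf| ≤ m′` on `B` ⟹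
  **`|f(x₀+e_μ) − f(x₀)| ≤ K_4·M∕(R+1) + ((9/2)·K_4 + 36·C₁·C_ps)∕c₀²·(R+1)·m′`** — NO hypothesis, NO leaf: the (3.42)₂ SHAPE for the flat
  Laplacian in Bałaban's dimension (GR3 `fdiff_le_box` with `K = 3∕c₀²` from §3).
(unit `b2b-balaban-beta-d4-p2`, GEN 11, MODEL crew; claim «LATTICE-GRADIENT-MEMBER» journal l.23681; road P3 = unit `b2b-balaban-beta-d4-p3`.)

HONEST FRAMING: discharging `BetaPertH` makes Bałaban's UV stability UNCONDITIONAL — NOT the continuum limit, NOT the Clay problem.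
HONEST DEPENDENCY (verbatim): «continuum YM on T⁴ ⇐ BetaPertH ∧ nine spine estimates (0/9 proved); BetaPertH ⇐ (D1) ∧ (D4) ∧ CAP+tail;
G-an2-4 gates asym, D1 and NE2/3/4.»  THIS MODULE DISCHARGES NOTHING of `BetaPertH`, asserts NOTHING printed and cites nothing as a fact
(ABSOLUTE RULE): [folklore] discrete potential theory of the FREE torus Laplacian (constant weight, flat transport, d = 4); the multi-region
operator's gradient member is the OWNER's assembly; nothing of Bałaban's G′(U); print's (3.42)₂ is [B4] Lemma 2.2 — NOT reproduced.
LOCATORS (shape only): [Balaban1985BackgroundPropagators] Thm 3.1 (3.42) p. 397.  No class change on row D4 (critical-path width 0;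
D4 DISCHARGE NO DATE); NOT BetaPertH, NOT continuum, NOT Clay, NOT summit progress.
-/

open scoped BigOperators
open Finset

namespace Summit.QuantumFields.BalabanUV.Beta.GradientMemberBoxD4

open Literature.MathematicalPhysics.QuantumFieldTheory.Balaban1983to89
open Literature.MathematicalPhysics.QuantumFieldTheory.Balaban1983to89.B9Thm37GluePU (bsrc btgt)
open B4Sect5Torus (ccoord)
open B5TorusCover (UT)
open B5Leibniz121 (up)
open Summit.QuantumFields.BalabanUV.Beta.GraphGreenFunction (dirSol green dirSol_eq_on dirSol_eq_off dirSol_unique green_nonneg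
  green_le_of_supersolution green_eq_zero_of_not_mem_right)
open Summit.QuantumFields.BalabanUV.Beta.TorusBoxSupersolution (sum_src_const sum_tgt_const wsum_src_const wsum_tgt_const
  exists_unit_supersolution_box)
open Summit.QuantumFields.BalabanUV.Beta.TorusBallMeanValue (sqRad erad ccoord_le_erad)
open Summit.QuantumFields.BalabanUV.Beta.HarmonicMeasureBoundD4 (green_ball_le)
open Summit.QuantumFields.BalabanUV.Beta.HarmonicGradientInterior (Kgrad)
open Summit.QuantumFields.BalabanUV.Beta.TorusInversePowerSums (Cps)
open Summit.QuantumFields.BalabanUV.Beta.GreenGradientRowSum (Cdip)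
open Summit.QuantumFields.BalabanUV.Beta.GradientMemberBox (fdiff_le_box)

noncomputable section

/-! ## §1 Domain monotonicity of the Green's function (generic) -/

section Generic

variable {St Bd : Type} [Fintype St] [Fintype Bd] [DecidableEq St] (src tgt : Bd → St) (c : Bd → ℝ)

/-- **DOMAIN MONOTONICITY**: if `B ⊆ B′` and both carry nonnegative unit supersolutions then `green B x z ≤ green B′ x z` (the larger
Green's function is a supersolution with source `δ_z` on `B`, nonnegative off `B`). [folklore] -/
theorem green_mono_set (B B' : Finset St) (hBB' : B ⊆ B') (w₀ w₀' : St → ℝ) (hw₀0 : ∀ y, 0 ≤ w₀ y)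
    (hw₀ : ∀ x ∈ B, 1 + ((∑ b ∈ univ.filter (fun b => tgt b = x), c b ^ 2 * w₀ (src b)) +
        ∑ b ∈ univ.filter (fun b => src b = x), c b ^ 2 * w₀ (tgt b)) ≤
      ((∑ b ∈ univ.filter (fun b => tgt b = x), c b ^ 2) + ∑ b ∈ univ.filter (fun b => src b = x), c b ^ 2) * w₀ x)
    (hw₀0' : ∀ y, 0 ≤ w₀' y)
    (hw₀' : ∀ x ∈ B', 1 + ((∑ b ∈ univ.filter (fun b => tgt b = x), c b ^ 2 * w₀' (src b)) +
        ∑ b ∈ univ.filter (fun b => src b = x), c b ^ 2 * w₀' (tgt b)) ≤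
      ((∑ b ∈ univ.filter (fun b => tgt b = x), c b ^ 2) + ∑ b ∈ univ.filter (fun b => src b = x), c b ^ 2) * w₀' x)
    (x z : St) : green src tgt c B x z ≤ green src tgt c B' x z := by
  refine green_le_of_supersolution src tgt c B w₀ hw₀0 hw₀ z (fun y => green src tgt c B' y z)
    (fun y _ => green_nonneg src tgt c B' w₀' hw₀0' hw₀' y z) (fun y hy => ?_) x
  have h := dirSol_eq_on src tgt c B' w₀' hw₀0' hw₀' (fun w => if w = z then (1 : ℝ) else 0) y (hBB' hy)
  simp only [green]
  rw [h]

end Generic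

/-! ## §2 The constant-weight Green's function on the torus: weight scaling; the sup distance against the squared radius -/

section Torus

variable {d : ℕ} {N : Fin d → ℕ} [∀ i, NeZero (N i)]

/-- **WEIGHT SCALING**: for the constant weight `c ≡ c₀ ≠ 0` and any finite `B` carrying unit supersolutions for both weights,
`green_c B x z = green_1 B x z ∕ c₀²`. [folklore] -/
theorem green_const_weight [NeZero d] {c : UT N × Fin d → ℝ} {c₀ : ℝ} (hc : ∀ b, c b = c₀) (hc₀ : c₀ ≠ 0) (B : Finset (UT N))
    (w₀ : UT N → ℝ) (hw₀0 : ∀ y, 0 ≤ w₀ y)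
    (hw₀ : ∀ x ∈ B, 1 + ((∑ b ∈ univ.filter (fun b : UT N × Fin d => btgt b = x), c b ^ 2 * w₀ (bsrc b)) +
        ∑ b ∈ univ.filter (fun b : UT N × Fin d => bsrc b = x), c b ^ 2 * w₀ (btgt b)) ≤
      ((∑ b ∈ univ.filter (fun b : UT N × Fin d => btgt b = x), c b ^ 2) +
        ∑ b ∈ univ.filter (fun b : UT N × Fin d => bsrc b = x), c b ^ 2) * w₀ x)
    (w₁ : UT N → ℝ) (hw₁0 : ∀ y, 0 ≤ w₁ y)
    (hw₁ : ∀ x ∈ B, 1 + ((∑ b ∈ univ.filter (fun b : UT N × Fin d => btgt b = x), (fun _ : UT N × Fin d => (1 : ℝ)) b ^ 2 * w₁ (bsrc b)) +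
        ∑ b ∈ univ.filter (fun b : UT N × Fin d => bsrc b = x), (fun _ : UT N × Fin d => (1 : ℝ)) b ^ 2 * w₁ (btgt b)) ≤
      ((∑ b ∈ univ.filter (fun b : UT N × Fin d => btgt b = x), (fun _ : UT N × Fin d => (1 : ℝ)) b ^ 2) +
        ∑ b ∈ univ.filter (fun b : UT N × Fin d => bsrc b = x), (fun _ : UT N × Fin d => (1 : ℝ)) b ^ 2) * w₁ x)
    (x z : UT N) :
    green bsrc btgt c B x z = green bsrc btgt (fun _ : UT N × Fin d => (1 : ℝ)) B x z / c₀ ^ 2 := by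
  have h1c : ∀ b : UT N × Fin d, (fun _ : UT N × Fin d => (1 : ℝ)) b = 1 := fun _ => rfl
  set u₁ : UT N → ℝ := dirSol bsrc btgt (fun _ : UT N × Fin d => (1 : ℝ)) B (fun w => if w = z then 1 else 0) with hu₁
  -- `u₁ / c₀²` solves the `c`-weighted Dirichlet problem with source `δ_z`
  have key : (fun y => u₁ y / c₀ ^ 2) = dirSol bsrc btgt c B (fun w => if w = z then 1 else 0) := by
    refine dirSol_unique bsrc btgt c B w₀ hw₀0 hw₀ _ _ (fun y hy => ?_) (fun y hy => ?_)
    · show u₁ y / c₀ ^ 2 = 0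
      rw [hu₁, dirSol_eq_off bsrc btgt _ B w₁ hw₁0 hw₁ _ y hy, zero_div]
    · have h := dirSol_eq_on bsrc btgt _ B w₁ hw₁0 hw₁ (fun w => if w = z then (1 : ℝ) else 0) y hy
      rw [sum_tgt_const h1c, sum_src_const h1c, wsum_tgt_const h1c, wsum_src_const h1c] at h
      rw [sum_tgt_const hc, sum_src_const hc, wsum_tgt_const hc (fun y => u₁ y / c₀ ^ 2), wsum_src_const hc (fun y => u₁ y / c₀ ^ 2)]
      rw [← h]
      simp only [← Finset.sum_div]
      field_simp
      ring
  have := congrFun key x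
  simp only [green]
  rw [← this]

omit [∀ i, NeZero (N i)] in
/-- The torus distance is the largest circular coordinate distance. [folklore] -/
theorem dist_eq_natSup [∀ i, NeZero (N i)] (x x₀ : UT N) :
    dist x x₀ = ((univ.sup (ccoord N (UT.toSite N x) (UT.toSite N x₀)) : ℕ) : ℝ) := rfl

omit [∀ i, NeZero (N i)] in
/-- `(max_ν δ_ν)² ≤ Σ_ν δ_ν² = sqRad`. [folklore] -/
theorem sup_sq_le_sqRad [NeZero d] (x x₀ : UT N) :
    (univ.sup (ccoord N (UT.toSite N x) (UT.toSite N x₀))) ^ 2 ≤ sqRad x₀ x := by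
  obtain ⟨ν₀, -, hν₀⟩ := Finset.exists_mem_eq_sup (univ : Finset (Fin d)) Finset.univ_nonempty
    (ccoord N (UT.toSite N x) (UT.toSite N x₀))
  rw [hν₀, sqRad]
  exact Finset.single_le_sum (f := fun ν => ccoord N (UT.toSite N x) (UT.toSite N x₀) ν ^ 2) (fun _ _ => Nat.zero_le _)
    (Finset.mem_univ ν₀)

omit [∀ i, NeZero (N i)] in
/-- `sqRad ≤ d·(max_ν δ_ν)²`. [folklore] -/
theorem sqRad_le_card_mul (x x₀ : UT N) :
    sqRad x₀ x ≤ d * (univ.sup (ccoord N (UT.toSite N x) (UT.toSite N x₀))) ^ 2 := by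
  rw [sqRad]
  calc ∑ ν, ccoord N (UT.toSite N x) (UT.toSite N x₀) ν ^ 2 ≤ ∑ _ν : Fin d, (univ.sup (ccoord N (UT.toSite N x) (UT.toSite N x₀))) ^ 2 :=
        Finset.sum_le_sum fun ν _ => Nat.pow_le_pow_left (Finset.le_sup (Finset.mem_univ ν)) 2
    _ = d * (univ.sup (ccoord N (UT.toSite N x) (UT.toSite N x₀))) ^ 2 := by
        rw [Finset.sum_const, Finset.card_univ, Fintype.card_fin, smul_eq_mul]

end Torus

/-! ## §3 d = 4: the pointwise Green bound on a sup-ball -/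

section D4

variable {N : Fin 4 → ℕ} [∀ i, NeZero (N i)]

omit [∀ i, NeZero (N i)] in
/-- `⌊|x − x₀|⌋ ≤ 2·dist(x,x₀)` in `d = 4` (`sqRad ≤ 4·dist²`). [folklore] -/
theorem erad_le_two_mul (x x₀ : UT N) : erad x₀ x ≤ 2 * univ.sup (ccoord N (UT.toSite N x) (UT.toSite N x₀)) := by
  rw [erad]
  have h := sqRad_le_card_mul (N := N) x x₀
  have e : 4 * (univ.sup (ccoord N (UT.toSite N x) (UT.toSite N x₀))) ^ 2 = (2 * univ.sup (ccoord N (UT.toSite N x) (UT.toSite N x₀))) *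
      (2 * univ.sup (ccoord N (UT.toSite N x) (UT.toSite N x₀))) := by ring
  rw [e] at h
  calc Nat.sqrt (sqRad x₀ x) ≤ Nat.sqrt ((2 * univ.sup (ccoord N (UT.toSite N x) (UT.toSite N x₀))) *
      (2 * univ.sup (ccoord N (UT.toSite N x) (UT.toSite N x₀)))) := Nat.sqrt_le_sqrt h
    _ = 2 * univ.sup (ccoord N (UT.toSite N x) (UT.toSite N x₀)) := Nat.sqrt_eq _

/-- **THE POINTWISE GREEN BOUND ON A SUP-BALL, d = 4**: constant weight `c ≡ c₀ ≠ 0`, `B = {dist(·,x₀) ≤ r}`, `16r + 4 ≤ N_μ`; then for ALL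
`x′, y`: `green_c B x′ y ≤ (3∕c₀²)·((dist x′ y + 1)²)⁻¹`.  For `y ∈ B`: `B ⊆ {⌊|· − y|⌋ < 4r+1}` (`erad ≤ 2·dist`, `dist ≤ 2r`), road P3's
`green_ball_le` at the centre `y` gives `green_1 ≤ (3/2)(sqRad + 3)⁻¹ ≤ 3·((dist+1)²)⁻¹` (`dist² ≤ sqRad`, `(D+1)² ≤ 2(D²+3)`), and weight
scaling divides by `c₀²`; for `y ∉ B` the Green's function vanishes. [folklore] -/
theorem green_box_le_d4 {c : UT N × Fin 4 → ℝ} {c₀ : ℝ} (hc : ∀ b, c b = c₀) (hc₀ : c₀ ≠ 0) (x₀ : UT N) {r : ℕ}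
    (hN : ∀ μ, 16 * r + 4 ≤ N μ) (x' y : UT N) :
    green bsrc btgt c (univ.filter (fun z : UT N => dist z x₀ ≤ r)) x' y ≤ 3 / c₀ ^ 2 * ((dist x' y + 1) ^ 2)⁻¹ := by
  classical
  set B := univ.filter (fun z : UT N => dist z x₀ ≤ r) with hB
  have h1c : ∀ b : UT N × Fin 4, (fun _ : UT N × Fin 4 => (1 : ℝ)) b = 1 := fun _ => rfl
  have hc2 : (0 : ℝ) < c₀ ^ 2 := by positivity
  have hD0 : 0 ≤ dist x' y := dist_nonneg
  -- unit supersolutions on `B` for both weights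
  have hr : ∀ μ, 2 * r + 2 ≤ N μ := fun μ => by have := hN μ; omega
  obtain ⟨w₀, hw₀0, -, hw₀⟩ := exists_unit_supersolution_box hc hc₀ x₀ hr
  obtain ⟨w₁, hw₁0, -, hw₁⟩ := exists_unit_supersolution_box (c := fun _ : UT N × Fin 4 => (1 : ℝ)) (c₀ := 1) h1c one_ne_zero x₀ hr
  by_cases hy : y ∈ B
  · -- the comparison ball around the pole
    set n : ℕ := 4 * r + 1 with hn
    have hnN : ∀ μ, 2 * n + 2 ≤ N μ := fun μ => by have := hN μ; omega
    set B' := univ.filter (fun z : UT N => erad y z < n) with hB'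
    obtain ⟨w₁', hw₁0', -, hw₁'⟩ := exists_unit_supersolution_box (c := fun _ : UT N × Fin 4 => (1 : ℝ)) (c₀ := 1) h1c one_ne_zero y hnN
    have hw₁'B : ∀ x ∈ B', 1 + ((∑ b ∈ univ.filter (fun b : UT N × Fin 4 => btgt b = x), (fun _ : UT N × Fin 4 => (1 : ℝ)) b ^ 2 * w₁' (bsrc b)) +
        ∑ b ∈ univ.filter (fun b : UT N × Fin 4 => bsrc b = x), (fun _ : UT N × Fin 4 => (1 : ℝ)) b ^ 2 * w₁' (btgt b)) ≤
      ((∑ b ∈ univ.filter (fun b : UT N × Fin 4 => btgt b = x), (fun _ : UT N × Fin 4 => (1 : ℝ)) b ^ 2) +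
        ∑ b ∈ univ.filter (fun b : UT N × Fin 4 => bsrc b = x), (fun _ : UT N × Fin 4 => (1 : ℝ)) b ^ 2) * w₁' x := by
      intro x hx
      refine hw₁' x (Finset.mem_filter.mpr ⟨Finset.mem_univ _, ?_⟩)
      exact TorusBallMeanValue.dist_le_of_erad_le y x (Finset.mem_filter.mp hx).2.le
    -- `B ⊆ B'`
    have hsub : B ⊆ B' := by
      intro z hz
      have hzr : dist z x₀ ≤ r := (Finset.mem_filter.mp hz).2
      have hyr : dist y x₀ ≤ r := (Finset.mem_filter.mp hy).2
      have hzy : dist z y ≤ 2 * r := by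
        have := dist_triangle z x₀ y
        rw [dist_comm x₀ y] at this
        linarith
      refine Finset.mem_filter.mpr ⟨Finset.mem_univ _, ?_⟩
      have h1 := erad_le_two_mul z y
      have h2 : ((univ.sup (ccoord N (UT.toSite N z) (UT.toSite N y)) : ℕ) : ℝ) ≤ 2 * r := by rw [← dist_eq_natSup]; exact hzy
      have h3 : univ.sup (ccoord N (UT.toSite N z) (UT.toSite N y)) ≤ 2 * r := by exact_mod_cast h2
      omega
    -- the chain of comparisons for the unit weight
    have hmono := green_mono_set bsrc btgt (fun _ : UT N × Fin 4 => (1 : ℝ)) B B' hsub w₁ w₁' hw₁0 hw₁ hw₁0' hw₁'B x' y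
    have hball := green_ball_le y (fun z => 1 / ((sqRad y z : ℝ) + 3)) (fun _ => rfl) hnN x'
    have hψ : 3 / 2 * max (1 / ((sqRad y x' : ℝ) + 3) - 1 / (((n : ℝ) + 1) ^ 2 + 3)) 0 ≤ 3 * ((dist x' y + 1) ^ 2)⁻¹ := by
      have hL : 0 ≤ 1 / (((n : ℝ) + 1) ^ 2 + 3) := by positivity
      have hmax : max (1 / ((sqRad y x' : ℝ) + 3) - 1 / (((n : ℝ) + 1) ^ 2 + 3)) 0 ≤ 1 / ((sqRad y x' : ℝ) + 3) :=
        max_le (by linarith) (by positivity)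
      -- `dist² ≤ sqRad` and `(D+1)² ≤ 2(D² + 3)`
      have hsq : dist x' y ^ 2 ≤ (sqRad y x' : ℝ) := by
        rw [dist_eq_natSup]
        exact_mod_cast sup_sq_le_sqRad x' y
      have hkey : 1 / ((sqRad y x' : ℝ) + 3) ≤ 2 * ((dist x' y + 1) ^ 2)⁻¹ := by
        rw [← div_eq_mul_inv, div_le_div_iff₀ (by positivity) (by positivity)]
        nlinarith
      linarith
    calc green bsrc btgt c B x' y = green bsrc btgt (fun _ : UT N × Fin 4 => (1 : ℝ)) B x' y / c₀ ^ 2 :=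
          green_const_weight hc hc₀ B w₀ hw₀0 hw₀ w₁ hw₁0 hw₁ x' y
      _ ≤ green bsrc btgt (fun _ : UT N × Fin 4 => (1 : ℝ)) B' x' y / c₀ ^ 2 := div_le_div_of_nonneg_right hmono hc2.le
      _ ≤ 3 * ((dist x' y + 1) ^ 2)⁻¹ / c₀ ^ 2 := div_le_div_of_nonneg_right (hball.trans hψ) hc2.le
      _ = 3 / c₀ ^ 2 * ((dist x' y + 1) ^ 2)⁻¹ := by ring
  · rw [green_eq_zero_of_not_mem_right bsrc btgt c B w₀ hw₀0 hw₀ x' y hy]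
    positivity

/-! ## §4 THE GRADIENT MEMBER ON A TORUS BOX, d = 4, hypothesis-free -/

/-- **THE GRADIENT MEMBER (3.42)₂'s SHAPE ON A TORUS BOX IN d = 4 — NO HYPOTHESIS, NO LEAF.**  Constant weight `c ≡ c₀ ≠ 0`, flat transport,
`R ≥ 1`, `32R + 36 ≤ N_μ`, `B = {dist(·,x₀) ≤ 2R+2}`, `|f| ≤ M` and `|W·f − Nf| ≤ m′` (`m′ ≥ 0`) on `B`.  Then for every axis `μ`:
`|f(x₀+e_μ) − f(x₀)| ≤ K_4·M∕(R+1) + ((9/2)·K_4 + 36·C₁·C_ps)∕c₀²·(R+1)·m′` (GR3 `fdiff_le_box` with the pointwise Green bound of §3, `K = 3∕c₀²`).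
[cite: Balaban1985BackgroundPropagators, Thm 3.1 (3.42) p.397; Balaban1983RegularityDecay, Lemma 2.2 (2.17) p.577] [folklore] -/
theorem fdiff_le_box_d4 {c : UT N × Fin 4 → ℝ} {c₀ : ℝ} (hc : ∀ b, c b = c₀) (hc₀ : c₀ ≠ 0) (x₀ : UT N) {R : ℕ} (hR : 1 ≤ R)
    (hN : ∀ μ, 32 * R + 36 ≤ N μ) (f : UT N → ℝ) {M m' : ℝ} (hm' : 0 ≤ m')
    (hM : ∀ y ∈ univ.filter (fun y : UT N => dist y x₀ ≤ 2 * R + 2), |f y| ≤ M)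
    (hsrc : ∀ y ∈ univ.filter (fun y : UT N => dist y x₀ ≤ 2 * R + 2),
      |((∑ b ∈ univ.filter (fun b : UT N × Fin 4 => btgt b = y), c b ^ 2) +
            ∑ b ∈ univ.filter (fun b : UT N × Fin 4 => bsrc b = y), c b ^ 2) * f y -
          ((∑ b ∈ univ.filter (fun b : UT N × Fin 4 => btgt b = y), c b ^ 2 * f (bsrc b)) +
            ∑ b ∈ univ.filter (fun b : UT N × Fin 4 => bsrc b = y), c b ^ 2 * f (btgt b))| ≤ m')
    (μ : Fin 4) :
    |f (up x₀ μ) - f x₀| ≤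
      Kgrad 4 * M / ((R : ℝ) + 1) + (9 / 2 * Kgrad 4 + 36 * Cdip 4 * Cps 4) / c₀ ^ 2 * ((R : ℝ) + 1) * m' := by
  have hc2 : (0 : ℝ) < c₀ ^ 2 := by positivity
  have hK : (0 : ℝ) ≤ 3 / c₀ ^ 2 := by positivity
  have hN' : ∀ i, 10 * R + 4 ≤ N i := fun i => by have := hN i; omega
  have hNr : ∀ μ', 16 * (2 * R + 2) + 4 ≤ N μ' := fun μ' => by have := hN μ'; omega
  have ecast : ((2 * R + 2 : ℕ) : ℝ) = 2 * (R : ℝ) + 2 := by push_cast; ring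
  have hG : ∀ x' y : UT N, green bsrc btgt c (univ.filter (fun y : UT N => dist y x₀ ≤ 2 * R + 2)) x' y ≤
      3 / c₀ ^ 2 * ((dist x' y + 1) ^ (4 - 2))⁻¹ := by
    intro x' y
    have h := green_box_le_d4 hc hc₀ x₀ hNr x' y
    rw [ecast] at h
    exact h
  have h := fdiff_le_box hc hc₀ x₀ hR hN' hK hG f hm' hM hsrc μ
  have e : (9 / 2 * Kgrad 4 / c₀ ^ 2 + 12 * Cdip 4 * Cps 4 * (3 / c₀ ^ 2)) = (9 / 2 * Kgrad 4 + 36 * Cdip 4 * Cps 4) / c₀ ^ 2 := by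
    field_simp; ring
  rw [e] at h
  exact h

end D4

end

end Summit.QuantumFields.BalabanUV.Beta.GradientMemberBoxD4
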